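import Summits.BirchSwinnertonDyer.Rank1Residual.GaloisImage.KolyvaginInjectivityAllDepthsLe
import Summits.BirchSwinnertonDyer.Rank1Residual.GaloisImage.KolyvaginBaseRigidityDeep
import Summits.BirchSwinnertonDyer.Rank1Residual.GaloisImage.PropagatedStructureUnramified
import HarnessLib

/-!
# Injectivity at the core vertex `∅` on `KS(E[3^k·3], 𝓕_can)` at EVERY depth, [S24]-free: the
# `m = 1` base discharged by base rigidity on the deep class
# (cell `b2b-bsdres`, team n1011, row T-INJ-DEV-K, END file; seat p11 GEN 6; lead R5-69/R5-70
# ADD 3 ("your `hinj₁` at a deep class on E[3] is then fed by F-E1 §3 BY NAME"); skeleton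
# `cells/n1011/skel/T-INJ-DEV-FB.md`)

HONEST FRAMING (cell `b2b-bsdres`, run/shared/lean/b2b/bsd-rank1-residual/, verbatim in every
file): the goal of the cell is to DELETE the COMBINATION-SHAPED residual classes of the
Birch–Swinnerton-Dyer formula for ALL analytic-rank `≤ 1` elliptic curves over `ℚ` — "full BSD
formula for every rank `≤ 1` curve in class `C`" assembled STRICTLY from published theorems — so
that the rank-`≤ 1` remainder becomes exactly the CONSTRUCTION-SHAPED classes, which are TYPED
(missing-input `Prop`s), NOT attempted. This is not "finishing BSD". Team n1011 (N10 / N11, the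
additive block X4 ∧ `p = 3`): research route on the CONSTRUCTION-SHAPED class X4; TOOL theorems; no
class theorem; nothing is booked; no label and no RESIDUAL-MAP mark is moved. Theorems only: no
definition, no named fact, no `sorry`.

## What

* `TorsionLevel.geomTorsion_three_eq_zero_of_fixed_of_surj` — `E(ℚ̄)[3]^{Γ_ℚ} = 0` under surj(3)
  (T-R18c `geomPoints_eq_zero_of_fixed_of_pow_smul_eq_zero`), the `E[3]` reading of n1011-p11's
  `Transport.geomTorsion_eq_zero_of_fixed_of_surj`.
* **`TorsionLevel.apply_eq_zero_of_apply_empty_eq_zero_allDepths`** — for `E/ℚ` with `ρ̄_{E,3}`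
  onto, `S ⊇ ∞ ∪ {3} ∪ {bad}`, `τ ∈ Gal(ℚ̄/ℚ(μ_{3^{k+1}}))` with cyclic cokernels on `E[3^j·3]`
  (`j ≤ k`) and on `E[3]`, a Poitou–Tate family `inv` with Tate's local Euler characteristic `hEP`,
  and canonical admissible Kolyvagin data `D j` (`j ≤ k`) on `E[3^j·3]` and `D₁` on `E[3]`, ALL on
  Sakamoto's class of `τ` at level `3^{k+1}` with cyclotomic transverse conditions and ONE `η`:
  if `H¹_{𝓕̄_can^*}(ℚ, E[3]^∨(1)) = 0` (`∅` is a core vertex), then every Kolyvagin system of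
  `(E[3^k·3], 𝓕_can, D k)` with `κ_∅ = 0` vanishes — for EVERY `k ≥ 1`.  Assembly of K2/K3
  (`apply_eq_zero_of_apply_eq_zero_allDepths_le`, n1011-p11) over n1011-p15's deep base rigidity
  `kolyvaginSystem_eq_zero_of_apply_empty_eq_zero_of_baseRigidity_deep` (F-E1 §3 = R1-58 on the
  `E[3]`-datum over the deep class + Sakamoto Cor. 5.5 on the deep class); NO [S24] binder, NO
  four-class / coisotropy input.  Subgroup form `injective_eval_kolyvaginSystems_empty_allDepths`.

HYPOTHESES left (nothing hidden): surj(3); (H.2)-cokernels for `τ` at levels `≤ k` (tower rows);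
`inv` perfect/sum/complement + `hEP`; canonical data + admissibility at levels `≤ k` (n1011-p04's
constructor, n1011-p11 GEN 4 `isAdmissible_of_hasCanonicalComparison_…`); `hcore`.  Debt reduction
inside the S24-DEEP port (its clause (1)'s injectivity half at `∅`), NOT coverage; nothing booked.

References: R. Sakamoto, JTNB 36 (2024) Thm. 4.4 (1), Cor. 5.5, Prop. 7.6 [Sakamoto2024];
K. Rubin, PCMI 18 (2011) Prop. 2.3.2 (1), Cor. 2.8.9 [Rubin2011]; B. Mazur, K. Rubin, Mem. AMS 799
(2004) Thm. 4.4.1.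
-/

noncomputable section

open scoped Classical NumberField ContRepresentation
open Field NumberField IsDedekindDomain Module
open WeierstrassCurve Literature.NumberTheory.EllipticCurves Literature.NumberTheory.GaloisRepresentations
  Literature.NumberTheory.GaloisRepresentations.DiscreteGaloisModule Literature.NumberTheory.GaloisCohomology

namespace Summit.BirchSwinnertonDyer.Rank1Residual.GaloisImage.TorsionLevel

variable (W : WeierstrassCurve ℚ) [W.IsElliptic]

/-- **`E(ℚ̄)[3]^{Γ_ℚ} = 0` under surj(3)** (in the `E[3]` spelling; `E[3^j·3]` is n1011-p11's
`Transport.geomTorsion_eq_zero_of_fixed_of_surj`). [cite: Serre1972, §5.2 (iv) and §5.4] -/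
theorem geomTorsion_three_eq_zero_of_fixed_of_surj (hsurj : W.HasSurjectiveModNGaloisRep ((3 : ℕ) : ℤ))
    (P : geomTorsion W ((3 : ℕ) : ℤ))
    (hP : ∀ σ : absoluteGaloisGroup ℚ, W.torsionGaloisModule ((3 : ℕ) : ℤ) σ P = P) : P = 0 := by
  haveI : Fact (Nat.Prime 3) := ⟨Nat.prime_three⟩
  have hirr := hasIrreducibleModPGaloisRep_of_hasSurjectiveModNGaloisRep W 3 hsurj
  apply Subtype.ext
  refine geomPoints_eq_zero_of_fixed_of_pow_smul_eq_zero W 3 (by norm_num) hirr (U := ⊤) le_top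
    (P : geomPoints W) (fun σ _ => ?_) 1 ?_
  · have h := hP σ
    rw [torsionGaloisModule_apply_apply] at h
    exact congrArg Subtype.val h
  · have h := (mem_geomTorsion_iff W ((3 : ℕ) : ℤ) _).mp P.2
    rw [pow_one, ← natCast_zsmul]
    exact h

/-- **Injectivity at the core vertex `∅` on `KS(E[3^k·3], 𝓕_can, D k)` for EVERY `k ≥ 1`, with the
`m = 1` base DISCHARGED** by n1011-p15's deep base rigidity (F-E1, R1-58 on the `E[3]`-datum over the
class of level `3^{k+1}`): every Kolyvagin system with `κ_∅ = 0` vanishes, when `∅` is a core vertex of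
`𝓕̄_can` (`hcore`).  NO [S24] binder; no four-class prime choice; no coisotropy.
[cite: Sakamoto2024, Thm. 4.4 (1) (p. 926) and Prop. 7.6 (p. 936)] [cite: Rubin2011, Cor. 2.8.9 (2) (p. 25)] -/
theorem apply_eq_zero_of_apply_empty_eq_zero_allDepths [Finite (geomTorsion W ((3 : ℕ) : ℤ))]
    (h3 : W.HasSurjectiveModNGaloisRep ((3 : ℕ) : ℤ)) (k : ℕ) (hk : 1 ≤ k)
    (τ : absoluteGaloisGroup ℚ) (hτμ : τ ∈ rootsOfUnityFixer ℚ (3 ^ (k + 1)))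
    (hτ : ∀ j, j ≤ k → Nonempty (cokerSubOne (W.torsionGaloisModule (((3 : ℕ) : ℤ) ^ j * ((3 : ℕ) : ℤ))) τ ≃+
      ZMod (3 ^ (j + 1))))
    (hτq : Nonempty (cokerSubOne (W.torsionGaloisModule ((3 : ℕ) : ℤ)) τ ≃+ ZMod 3))
    (inv : LocalInvariants ℚ 3) (hperf : inv.IsPerfect) (hsum : inv.SumLocalTermEqZero)
    (hcompl : inv.SelmerComplement)
    (hEP : ∀ v : HeightOneSpectrum (𝓞 ℚ), localEulerPoincareCharacteristic (v.adicCompletion ℚ))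
    (S : Finset (Place ℚ)) (hS : ∀ w : InfinitePlace ℚ, (Sum.inl w : Place ℚ) ∈ S)
    (h3S : ∀ v : HeightOneSpectrum (𝓞 ℚ), ((3 : ℕ) : 𝓞 ℚ) ∈ v.asIdeal → (Sum.inr v : Place ℚ) ∈ S)
    (hbadS : ∀ v : HeightOneSpectrum (𝓞 ℚ), ¬ W.HasGoodReductionAt v → (Sum.inr v : Place ℚ) ∈ S)
    (D : (j : ℕ) → KolyvaginDatum (W.torsionGaloisModule (((3 : ℕ) : ℤ) ^ j * ((3 : ℕ) : ℤ))))
    (D₁ : KolyvaginDatum (W.torsionGaloisModule ((3 : ℕ) : ℤ)))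
    (η : (q : HeightOneSpectrum (𝓞 ℚ)) → (ZMod (Ideal.absNorm q.asIdeal))ˣ)
    (hP : ∀ j, j ≤ k → (D j).primes = frobeniusClassPrimes
      (W.torsionGaloisModule (((3 : ℕ) : ℤ) ^ k * ((3 : ℕ) : ℤ))) {v | (Sum.inr v : Place ℚ) ∈ S} τ (3 ^ (k + 1)))
    (hP₁ : D₁.primes = frobeniusClassPrimes
      (W.torsionGaloisModule (((3 : ℕ) : ℤ) ^ k * ((3 : ℕ) : ℤ))) {v | (Sum.inr v : Place ℚ) ∈ S} τ (3 ^ (k + 1)))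
    (hT : ∀ j, j ≤ k → (D j).transverse = cyclotomicTransverse _)
    (hT₁ : D₁.transverse = cyclotomicTransverse _)
    (hD : ∀ j, j ≤ k → (D j).HasCanonicalComparison (3 ^ (j + 1)) η) (hD₁ : D₁.HasCanonicalComparison 3 η)
    (hadm : ∀ j, j ≤ k → (D j).IsAdmissible)
    (hcore : (inv.dualSelmerStructure (W.torsionGaloisModule ((3 : ℕ) : ℤ))
      (D₁.atLevel (propagatedSelmerStructureOne W 3) ∅)).selmerGroup = ⊥)
    {κ : Finset (HeightOneSpectrum (𝓞 ℚ)) →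
      galoisCohomology (W.torsionGaloisModule (((3 : ℕ) : ℤ) ^ k * ((3 : ℕ) : ℤ))) 1}
    (hκ : (D k).IsKolyvaginSystem (propagatedSelmerStructure W 3 k) κ) (h0κ : κ ∅ = 0)
    (n : Finset (HeightOneSpectrum (𝓞 ℚ))) : κ n = 0 := by
  haveI : Fact (Nat.Prime 3) := ⟨Nat.prime_three⟩
  -- the `m = 1` base: base rigidity on the deep class (n1011-p15 F-E1 §3)
  have hinj₁ : ∀ lam : Finset (HeightOneSpectrum (𝓞 ℚ)) →
        galoisCohomology (W.torsionGaloisModule ((3 : ℕ) : ℤ)) 1,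
      D₁.IsKolyvaginSystem (propagatedSelmerStructureOne W 3) lam → lam ∅ = 0 → ∀ n, lam n = 0 :=
    fun lam hlam hlam0 =>
      kolyvaginSystem_eq_zero_of_apply_empty_eq_zero_of_baseRigidity_deep W h3 k τ hτμ hτq inv hperf hsum
        hcompl hEP S hS h3S hbadS D₁ η hP₁ hT₁ hD₁ lam hlam hcore hlam0
  refine apply_eq_zero_of_apply_eq_zero_allDepths_le W (geomTorsion_three_eq_zero_of_fixed_of_surj W h3)
    (propagatedSelmerStructureOne_three_isUnramifiedOutside W S hS h3S hbadS) hτq D D₁ hP₁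
    (fun q hq => hq.1) hT₁ hD₁ hinj₁ k hk (fun j _ P hP' => ?_)
    (fun j _ => propagatedSelmerStructure_isUnramifiedOutside W 3 j S hS h3S hbadS) hτμ hτ hP
    subset_rfl hT hD hadm hκ h0κ n
  -- no `Γ_ℚ`-fixed point on `E[3^j·3]` under surj(3)
  exact Transport.geomTorsion_eq_zero_of_fixed_of_surj W h3 j P fun σ => by
    have h := hP' σ
    rwa [torsionGaloisModule_apply_apply] at h

/-- **`κ ↦ κ_∅` is injective on `KS(E[3^k·3], 𝓕_can, D k)` for every `k ≥ 1`** when `∅` is a core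
vertex — subgroup form, [S24]-free. [cite: Sakamoto2024, Thm. 4.4 (1) (p. 926)] [cite: Rubin2011, Cor. 2.8.9 (2) (p. 25)] -/
theorem injective_eval_kolyvaginSystems_empty_allDepths [Finite (geomTorsion W ((3 : ℕ) : ℤ))]
    (h3 : W.HasSurjectiveModNGaloisRep ((3 : ℕ) : ℤ)) (k : ℕ) (hk : 1 ≤ k)
    (τ : absoluteGaloisGroup ℚ) (hτμ : τ ∈ rootsOfUnityFixer ℚ (3 ^ (k + 1)))
    (hτ : ∀ j, j ≤ k → Nonempty (cokerSubOne (W.torsionGaloisModule (((3 : ℕ) : ℤ) ^ j * ((3 : ℕ) : ℤ))) τ ≃+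
      ZMod (3 ^ (j + 1))))
    (hτq : Nonempty (cokerSubOne (W.torsionGaloisModule ((3 : ℕ) : ℤ)) τ ≃+ ZMod 3))
    (inv : LocalInvariants ℚ 3) (hperf : inv.IsPerfect) (hsum : inv.SumLocalTermEqZero)
    (hcompl : inv.SelmerComplement)
    (hEP : ∀ v : HeightOneSpectrum (𝓞 ℚ), localEulerPoincareCharacteristic (v.adicCompletion ℚ))
    (S : Finset (Place ℚ)) (hS : ∀ w : InfinitePlace ℚ, (Sum.inl w : Place ℚ) ∈ S)
    (h3S : ∀ v : HeightOneSpectrum (𝓞 ℚ), ((3 : ℕ) : 𝓞 ℚ) ∈ v.asIdeal → (Sum.inr v : Place ℚ) ∈ S)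
    (hbadS : ∀ v : HeightOneSpectrum (𝓞 ℚ), ¬ W.HasGoodReductionAt v → (Sum.inr v : Place ℚ) ∈ S)
    (D : (j : ℕ) → KolyvaginDatum (W.torsionGaloisModule (((3 : ℕ) : ℤ) ^ j * ((3 : ℕ) : ℤ))))
    (D₁ : KolyvaginDatum (W.torsionGaloisModule ((3 : ℕ) : ℤ)))
    (η : (q : HeightOneSpectrum (𝓞 ℚ)) → (ZMod (Ideal.absNorm q.asIdeal))ˣ)
    (hP : ∀ j, j ≤ k → (D j).primes = frobeniusClassPrimes
      (W.torsionGaloisModule (((3 : ℕ) : ℤ) ^ k * ((3 : ℕ) : ℤ))) {v | (Sum.inr v : Place ℚ) ∈ S} τ (3 ^ (k + 1)))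
    (hP₁ : D₁.primes = frobeniusClassPrimes
      (W.torsionGaloisModule (((3 : ℕ) : ℤ) ^ k * ((3 : ℕ) : ℤ))) {v | (Sum.inr v : Place ℚ) ∈ S} τ (3 ^ (k + 1)))
    (hT : ∀ j, j ≤ k → (D j).transverse = cyclotomicTransverse _)
    (hT₁ : D₁.transverse = cyclotomicTransverse _)
    (hD : ∀ j, j ≤ k → (D j).HasCanonicalComparison (3 ^ (j + 1)) η) (hD₁ : D₁.HasCanonicalComparison 3 η)
    (hadm : ∀ j, j ≤ k → (D j).IsAdmissible)
    (hcore : (inv.dualSelmerStructure (W.torsionGaloisModule ((3 : ℕ) : ℤ))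
      (D₁.atLevel (propagatedSelmerStructureOne W 3) ∅)).selmerGroup = ⊥) :
    Function.Injective fun κ : (D k).kolyvaginSystems (propagatedSelmerStructure W 3 k) => κ.1 ∅ := by
  intro κ κ' hκκ'
  have hmem : κ.1 - κ'.1 ∈ (D k).kolyvaginSystems (propagatedSelmerStructure W 3 k) := sub_mem κ.2 κ'.2
  have hd0 : (κ.1 - κ'.1) ∅ = 0 := by
    change κ.1 ∅ - κ'.1 ∅ = 0
    exact sub_eq_zero.mpr hκκ'
  have hall := apply_eq_zero_of_apply_empty_eq_zero_allDepths W h3 k hk τ hτμ hτ hτq inv hperf hsum hcompl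
    hEP S hS h3S hbadS D D₁ η hP hP₁ hT hT₁ hD hD₁ hadm hcore
    ((KolyvaginDatum.mem_kolyvaginSystems_iff _ _ _).mp hmem) hd0
  apply Subtype.ext
  funext m
  exact sub_eq_zero.mp (hall m)

end Summit.BirchSwinnertonDyer.Rank1Residual.GaloisImage.TorsionLevel

end
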